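import Literature.NumberTheory.EllipticCurves.TwoIsogenyDescentAlpha
import Mathlib.GroupTheory.Torsion
import HarnessLib

/-!
# `2`-primary torsion and the odd-multiple descent lemma on `y² = x³ + ax² + bx`
# (Silverman–Tate, *Rational Points on Elliptic Curves*, §3.5; Silverman, *AEC*, X.4.9)

Topic `Literature/NumberTheory/EllipticCurves`; companion of `TwoIsogenyDescentAlpha.lean` (the
homomorphism `α = xSqClass : E(F) → F*/F*²`, `α(x, y) = [x]`, `α(T) = [b]`, Silverman–Tate §3.5) and
`IsogenyTwoTorsionProofs.lean` (`E : y² = x³ + ax² + bx` in two-torsion normal form, `T = (0,0)`).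
Everything here is PROVED (theorems only; no definition, no named fact). For `W` over a field `F` in
two-torsion normal form (`a = a₂`, `b = a₄`), elliptic:

* `two_nsmul_eq_zero_iff_y_eq_zero`, `eq_zero_or_eq_twoTorsionPoint_of_two_nsmul_eq_zero` — if
  `a² − 4b` is not a square in `F`, the only points killed by `2` are `O` and `T` (the other
  `2`-torsion points have `x` a root of `x² + ax + b`, `(2x + a)² = a² − 4b`).
* `twoTorsionPoint_ne_two_nsmul` — if `b` is not a square in `F`, `T ∉ 2E(F)` (`α(2Q) = α(Q)² = 1`
  but `α(T) = [b] ≠ 1`; the argument of Zywina 2025 Lemma 3.4 in the tree's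
  `Zywina2025Torsion`, here for a general curve).
* `eq_zero_or_eq_twoTorsionPoint_of_two_pow_nsmul_eq_zero`, `exists_odd_nsmul_mem_pair` — hence
  `E(F)[2^∞] = {O, T}` and every torsion point of `E(F)` has an ODD multiple in `{O, T}`.
* `xSqClass_nsmul`, `xSqClass_zsmul`, `xSqClass_zsmul_of_odd`, `xSqClass_two_zsmul_add` — `α` kills
  `2E(F)` and `α(n • P) = α(P)` for odd `n` (the target has exponent `2`).
* **`ne_two_zsmul_add_of_oddMultiple`, `not_isOfFinAddOrder_of_oddMultiple`** — the ODD-MULTIPLE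
  DESCENT LEMMA: if `y − y' − 2•Z` is torsion, `μ • y' − λ • g` is torsion with `λ` odd, and
  `α(g) ∉ {1, [b]}`, then `y ∉ 2•E(F) + E(F)_tors`; in particular `y` has infinite order. (Under the
  two non-square hypotheses the torsion terms have odd multiples in `{O, T}`, whose `α`-values lie in
  `{1, [b]}`, while `α(λ • g) = α(g)` — a contradiction after multiplying through by an odd number.)
  This is the algebraic skeleton of the genus-character argument for Heegner points on curves with
  a rational `2`-isogeny (Tian 2014 §1 (1.3): `y_K ≡ P_χ (mod 2)`; Coates–Li–Tian–Zhai 2015 §2), with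
  the `2`-descent over the genus field replaced by the single homomorphism `α`.

## References

* J. H. Silverman, J. T. Tate, *Rational Points on Elliptic Curves*, 2nd ed., UTM (2015), §3.5
  (the homomorphism `α`). [SilvermanTate2015]
* J. H. Silverman, *The Arithmetic of Elliptic Curves*, 2nd ed., GTM 106 (2009), Prop. X.4.9,
  Group Law Algorithm III.2.3. [SilvermanAEC2009]
* Y. Tian, *Congruent numbers and Heegner points*, Camb. J. Math. 2 (2014), §1 (1.3). [Tian2014]

## Design

Dot-notation extensions in `namespace WeierstrassCurve` as in the sibling files; `open scoped
Classical` (the group law on `W.toAffine.Point`), hypotheses `[W.IsTwoTorsionNF] [W.IsElliptic]`.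
The non-square hypotheses are stated with Mathlib's `IsSquare`.
-/

noncomputable section

open scoped Classical

namespace WeierstrassCurve

open WeierstrassCurve.Affine (sqClass sqClass_mul sqClass_eq_one_iff)

variable {F : Type*} [Field F] (W : WeierstrassCurve F) [W.IsTwoTorsionNF] [W.IsElliptic]

/-! ### `α` on multiples -/

/-- `α(2P) = 1`: the target `F*/F*²` has exponent `2`. [cite: SilvermanTate2015, §3.5] -/
theorem xSqClass_two_nsmul (P : W.toAffine.Point) : W.xSqClass (2 • P) = 1 := by
  rw [two_nsmul, xSqClass_add, Affine.SqUnits.mul_self]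

/-- `α(n • P) = α(P)` for odd `n` and `= 1` for even `n` (`n : ℕ`). [cite: SilvermanTate2015, §3.5] -/
theorem xSqClass_nsmul (n : ℕ) (P : W.toAffine.Point) :
    W.xSqClass (n • P) = if Even n then 1 else W.xSqClass P := by
  induction n with
  | zero => rw [zero_nsmul, xSqClass_zero, if_pos (by decide)]
  | succ n ih =>
    rw [succ_nsmul, xSqClass_add, ih]
    by_cases hn : Even n
    · have hn1 : ¬ Even (n + 1) := fun h => (Nat.even_add_one.mp h) hn
      rw [if_pos hn, if_neg hn1, Affine.SqUnits.one_mul]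
    · rw [if_neg hn, if_pos (Nat.even_add_one.mpr hn), Affine.SqUnits.mul_self]

/-- `α(n • P) = α(P)` for odd `n` and `= 1` for even `n` (`n : ℤ`; `α(−P) = α(P)`).
[cite: SilvermanTate2015, §3.5] -/
theorem xSqClass_zsmul (n : ℤ) (P : W.toAffine.Point) :
    W.xSqClass (n • P) = if Even n then 1 else W.xSqClass P := by
  obtain ⟨m, rfl | rfl⟩ := Int.eq_nat_or_neg n
  · rw [natCast_zsmul, xSqClass_nsmul]
    exact if_congr (Int.even_coe_nat m).symm rfl rfl
  · rw [neg_smul, xSqClass_neg, natCast_zsmul, xSqClass_nsmul]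
    exact if_congr ((Int.even_coe_nat m).symm.trans even_neg.symm) rfl rfl

/-- `α(n • P) = α(P)` for odd `n : ℤ`. [cite: SilvermanTate2015, §3.5] -/
theorem xSqClass_zsmul_of_odd {n : ℤ} (hn : Odd n) (P : W.toAffine.Point) :
    W.xSqClass (n • P) = W.xSqClass P := by
  rw [xSqClass_zsmul, if_neg (Int.not_even_iff_odd.mpr hn)]

/-- `α(2 • R + t) = α(t)`: `α` kills `2E(F)`. [cite: SilvermanTate2015, §3.5] -/
theorem xSqClass_two_zsmul_add (R t : W.toAffine.Point) :
    W.xSqClass ((2 : ℤ) • R + t) = W.xSqClass t := by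
  rw [xSqClass_add, xSqClass_zsmul, if_pos (by decide), Affine.SqUnits.one_mul]

/-! ### Points killed by `2` -/

/-- On `y² = x³ + ax² + bx` an affine point `(x, y)` is killed by `2` iff `y = 0`
(`2 ≠ 0` in `F` as the curve is elliptic). [cite: SilvermanAEC2009, Group Law Algorithm III.2.3] -/
theorem two_nsmul_eq_zero_iff_y_eq_zero {x y : F} (h : W.toAffine.Nonsingular x y) :
    2 • (Affine.Point.some x y h : W.toAffine.Point) = 0 ↔ y = 0 := by
  have h2 := two_ne_zero' W
  rw [two_nsmul]
  constructor
  · intro hP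
    by_contra hy
    have hne : y ≠ W.toAffine.negY x y := by
      rw [negY_of_isTwoTorsionNF]
      intro e
      exact hy (by
        have : (2 : F) * y = 0 := by linear_combination e
        exact (mul_eq_zero.mp this).resolve_left h2)
    rw [Affine.Point.add_self_of_Y_ne hne] at hP
    exact Affine.Point.some_ne_zero _ hP
  · intro hy
    subst hy
    exact Affine.Point.add_self_of_Y_eq (by rw [negY_of_isTwoTorsionNF, neg_zero])

/-- **`E(F)[2] = {O, T}` when `a² − 4b` is not a square in `F`**: a point `(x, 0)` with `x ≠ 0` has
`x² + ax + b = 0`, so `(2x + a)² = a² − 4b`. [cite: SilvermanTate2015, §3.5] -/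
theorem eq_zero_or_eq_twoTorsionPoint_of_two_nsmul_eq_zero
    (hD : ¬ IsSquare (W.a₂ ^ 2 - 4 * W.a₄)) (P : W.toAffine.Point) (hP : 2 • P = 0) :
    P = 0 ∨ P = W.twoTorsionPoint := by
  rcases P with _ | ⟨x, y, h⟩
  · exact Or.inl rfl
  right
  have hy : y = 0 := (W.two_nsmul_eq_zero_iff_y_eq_zero h).mp hP
  by_cases hx : x = 0
  · subst hx hy; rfl
  · exfalso
    have e := rel_of_nonsingular W h
    rw [hy] at e
    have hq : x ^ 2 + W.a₂ * x + W.a₄ = 0 := by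
      have : x * (x ^ 2 + W.a₂ * x + W.a₄) = 0 := by linear_combination -e
      exact (mul_eq_zero.mp this).resolve_left hx
    exact hD ⟨2 * x + W.a₂, by linear_combination -4 * hq⟩

/-- **`T ∉ 2E(F)` when `b` is not a square in `F`** (`α(2Q) = 1`, `α(T) = [b] ≠ 1`).
[cite: SilvermanTate2015, §3.5] -/
theorem twoTorsionPoint_ne_two_nsmul (hb : ¬ IsSquare W.a₄) (Q : W.toAffine.Point) :
    2 • Q ≠ W.twoTorsionPoint := by
  intro hQ
  have hα := congrArg W.xSqClass hQ
  rw [xSqClass_two_nsmul, xSqClass_twoTorsionPoint, eq_comm, sqClass_eq_one_iff (a₄_ne_zero W)] at hα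
  obtain ⟨u, hu⟩ := hα
  exact hb ⟨u, by rw [hu, pow_two]⟩

/-- **`E(F)[2^∞] = {O, T}`** when neither `a² − 4b` nor `b` is a square in `F`: by induction on `k`,
`2^{k+1} Q = O` gives `2Q ∈ {O, T}`, and `2Q = T` is excluded. [cite: SilvermanTate2015, §3.5] -/
theorem eq_zero_or_eq_twoTorsionPoint_of_two_pow_nsmul_eq_zero
    (hD : ¬ IsSquare (W.a₂ ^ 2 - 4 * W.a₄)) (hb : ¬ IsSquare W.a₄) :
    ∀ (k : ℕ) (Q : W.toAffine.Point), 2 ^ k • Q = 0 → Q = 0 ∨ Q = W.twoTorsionPoint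
  | 0, Q, hQ => Or.inl (by rwa [pow_zero, one_nsmul] at hQ)
  | k + 1, Q, hQ => by
    rw [pow_succ', mul_nsmul] at hQ
    rcases eq_zero_or_eq_twoTorsionPoint_of_two_pow_nsmul_eq_zero hD hb k (2 • Q) hQ with h2 | h2
    · exact W.eq_zero_or_eq_twoTorsionPoint_of_two_nsmul_eq_zero hD Q h2
    · exact absurd h2 (W.twoTorsionPoint_ne_two_nsmul hb Q)

/-- **Every torsion point has an odd multiple in `{O, T}`** (write its order as `2^k · m`, `m` odd).
[cite: SilvermanTate2015, §3.5] -/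
theorem exists_odd_nsmul_mem_pair (hD : ¬ IsSquare (W.a₂ ^ 2 - 4 * W.a₄)) (hb : ¬ IsSquare W.a₄)
    {t : W.toAffine.Point} (ht : IsOfFinAddOrder t) :
    ∃ m : ℕ, Odd m ∧ (m • t = 0 ∨ m • t = W.twoTorsionPoint) := by
  obtain ⟨n, hn, hnt⟩ := ht.exists_nsmul_eq_zero
  obtain ⟨k, m, hm, rfl⟩ := Nat.exists_eq_two_pow_mul_odd hn.ne'
  refine ⟨m, hm, W.eq_zero_or_eq_twoTorsionPoint_of_two_pow_nsmul_eq_zero hD hb k (m • t) ?_⟩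
  rw [← mul_smul, hnt]

/-- The `α`-value of an odd multiple of a torsion point: for `t` torsion there is an odd `m` with
`α(m • t) ∈ {1, [b]}`. [cite: SilvermanTate2015, §3.5] -/
theorem exists_odd_xSqClass_nsmul_mem_pair (hD : ¬ IsSquare (W.a₂ ^ 2 - 4 * W.a₄))
    (hb : ¬ IsSquare W.a₄) {t : W.toAffine.Point} (ht : IsOfFinAddOrder t) :
    ∃ m : ℕ, Odd m ∧ (W.xSqClass ((m : ℤ) • t) = 1 ∨ W.xSqClass ((m : ℤ) • t) = sqClass W.a₄) := by
  obtain ⟨m, hm, h | h⟩ := W.exists_odd_nsmul_mem_pair hD hb ht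
  · exact ⟨m, hm, Or.inl (by rw [natCast_zsmul, h, xSqClass_zero])⟩
  · exact ⟨m, hm, Or.inr (by rw [natCast_zsmul, h, xSqClass_twoTorsionPoint])⟩

/-! ### The odd-multiple descent lemma -/

omit [W.IsTwoTorsionNF] [W.IsElliptic] in
/-- Torsion elements of an abelian group are closed under subtraction (restated on
`IsOfFinAddOrder` through `AddCommGroup.torsion`). [folklore] -/
private theorem tors_sub {A : Type*} [AddCommGroup A] {a b : A} (ha : IsOfFinAddOrder a)
    (hb : IsOfFinAddOrder b) : IsOfFinAddOrder (a - b) := by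
  rw [← AddCommGroup.mem_torsion] at ha hb ⊢
  exact sub_mem ha hb

omit [W.IsTwoTorsionNF] [W.IsElliptic] in
/-- Torsion elements of an abelian group are closed under integer multiples. [folklore] -/
private theorem tors_zsmul {A : Type*} [AddCommGroup A] (n : ℤ) {a : A} (ha : IsOfFinAddOrder a) :
    IsOfFinAddOrder (n • a) := by
  rw [← AddCommGroup.mem_torsion] at ha ⊢
  exact AddSubgroup.zsmul_mem _ ha n

/-- `α` of a torsion point lies in `{1, [b]}` after an odd rescaling that does not change the
`α`-value of the other (odd) terms: the bookkeeping step. If `t₁, t₂` are torsion there is an odd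
`m` with `α(m • t₁), α(m • t₂) ∈ {1, [b]}`. [cite: SilvermanTate2015, §3.5] -/
theorem exists_odd_xSqClass_nsmul_mem_pair₂ (hD : ¬ IsSquare (W.a₂ ^ 2 - 4 * W.a₄))
    (hb : ¬ IsSquare W.a₄) {t₁ t₂ : W.toAffine.Point} (h₁ : IsOfFinAddOrder t₁)
    (h₂ : IsOfFinAddOrder t₂) :
    ∃ m : ℕ, Odd m ∧
      (W.xSqClass ((m : ℤ) • t₁) = 1 ∨ W.xSqClass ((m : ℤ) • t₁) = sqClass W.a₄) ∧
      (W.xSqClass ((m : ℤ) • t₂) = 1 ∨ W.xSqClass ((m : ℤ) • t₂) = sqClass W.a₄) := by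
  obtain ⟨m₁, hm₁, e₁⟩ := W.exists_odd_xSqClass_nsmul_mem_pair hD hb h₁
  obtain ⟨m₂, hm₂, e₂⟩ := W.exists_odd_xSqClass_nsmul_mem_pair hD hb h₂
  refine ⟨m₁ * m₂, hm₁.mul hm₂, ?_, ?_⟩
  · have : ((m₁ * m₂ : ℕ) : ℤ) • t₁ = (m₂ : ℤ) • ((m₁ : ℤ) • t₁) := by
      rw [Nat.cast_mul, mul_comm, mul_smul]
    rw [this, W.xSqClass_zsmul_of_odd (by exact_mod_cast hm₂)]
    exact e₁
  · have : ((m₁ * m₂ : ℕ) : ℤ) • t₂ = (m₁ : ℤ) • ((m₂ : ℤ) • t₂) := by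
      rw [Nat.cast_mul, mul_smul]
    rw [this, W.xSqClass_zsmul_of_odd (by exact_mod_cast hm₁)]
    exact e₂

/-- **The odd-multiple descent lemma** (algebraic skeleton of the genus-character argument, Tian
2014 §1 (1.3), with the `2`-descent replaced by Silverman–Tate's homomorphism `α`). On
`E : y² = x³ + ax² + bx` over a field `F` in which neither `a² − 4b` nor `b` is a square, let
`y, y', Z, g ∈ E(F)` and `μ, λ ∈ ℤ` with `λ` odd satisfy: `y − y' − 2•Z` is torsion (`y ≡ y' (mod 2)`
up to torsion), `μ • y' − λ • g` is torsion, and `α(g) ∉ {1, [b]}`. Then `y ≠ 2 • R + t` for every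
`R ∈ E(F)` and every torsion `t`. Proof: otherwise `λ • g = 2 • (μ • (R − Z)) + τ` with `τ` torsion;
multiplying by an odd `m` with `α(m • τ-parts) ∈ {1, [b]}` and applying `α` gives `α(g) ∈ {1, [b]}`.
[cite: SilvermanTate2015, §3.5] [cite: Tian2014, §1 (1.3)] -/
theorem ne_two_zsmul_add_of_oddMultiple (hD : ¬ IsSquare (W.a₂ ^ 2 - 4 * W.a₄))
    (hb : ¬ IsSquare W.a₄) {y y' Z g : W.toAffine.Point} {μ l : ℤ} (hl : Odd l)
    (hG : IsOfFinAddOrder (y - y' - (2 : ℤ) • Z)) (hA : IsOfFinAddOrder (μ • y' - l • g))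
    (hg₁ : W.xSqClass g ≠ 1) (hg₂ : W.xSqClass g ≠ sqClass W.a₄)
    (R t : W.toAffine.Point) (ht : IsOfFinAddOrder t) : y ≠ (2 : ℤ) • R + t := by
  intro hy
  -- the two torsion terms `tG = y − y' − 2•Z`, `tA = μ•y' − l•g`
  set tG := y - y' - (2 : ℤ) • Z with htG
  set tA := μ • y' - l • g with htA
  -- `l • g = 2 • (μ • (R - Z)) + (μ • t - μ • tG - tA)`
  have key : l • g = (2 : ℤ) • (μ • (R - Z)) + (μ • t - μ • tG - tA) := by
    have e3 : l • g = μ • y' - tA := by rw [htA]; abel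
    have e4 : y' = y - (2 : ℤ) • Z - tG := by rw [htG]; abel
    rw [e3, e4, hy]
    module
  have hτ : IsOfFinAddOrder (μ • t - μ • tG - tA) :=
    tors_sub (tors_sub (tors_zsmul μ ht) (tors_zsmul μ hG)) hA
  -- odd rescaling putting the torsion term into `{O, T}` at the level of `α`
  obtain ⟨m, hm, hm1⟩ := W.exists_odd_xSqClass_nsmul_mem_pair hD hb hτ
  have hml : Odd ((m : ℤ) * l) := (by exact_mod_cast hm : Odd (m : ℤ)).mul hl
  have e2 : ((m : ℤ) * l) • g =
      (2 : ℤ) • ((m : ℤ) • (μ • (R - Z))) + (m : ℤ) • (μ • t - μ • tG - tA) := by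
    rw [mul_smul, key]
    module
  have hα := congrArg W.xSqClass e2
  rw [W.xSqClass_zsmul_of_odd hml, xSqClass_two_zsmul_add] at hα
  rcases hm1 with h | h
  · exact hg₁ (hα.trans h)
  · exact hg₂ (hα.trans h)

/-- **Corollary: `y` has infinite order** under the hypotheses of `ne_two_zsmul_add_of_oddMultiple`
(take `R = O`, `t = y`). [cite: SilvermanTate2015, §3.5] [cite: Tian2014, §1 (1.3)] -/
theorem not_isOfFinAddOrder_of_oddMultiple (hD : ¬ IsSquare (W.a₂ ^ 2 - 4 * W.a₄))
    (hb : ¬ IsSquare W.a₄) {y y' Z g : W.toAffine.Point} {μ l : ℤ} (hl : Odd l)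
    (hG : IsOfFinAddOrder (y - y' - (2 : ℤ) • Z)) (hA : IsOfFinAddOrder (μ • y' - l • g))
    (hg₁ : W.xSqClass g ≠ 1) (hg₂ : W.xSqClass g ≠ sqClass W.a₄) : ¬ IsOfFinAddOrder y :=
  fun hy => W.ne_two_zsmul_add_of_oddMultiple hD hb hl hG hA hg₁ hg₂ 0 y hy (by rw [smul_zero, zero_add])

/-- The same conclusion phrased with the torsion subgroup: `y ∉ 2•E(F) + E(F)_tors`.
[cite: SilvermanTate2015, §3.5] [cite: Tian2014, §1 (1.3)] -/
theorem not_mem_two_zsmul_add_torsion_of_oddMultiple (hD : ¬ IsSquare (W.a₂ ^ 2 - 4 * W.a₄))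
    (hb : ¬ IsSquare W.a₄) {y y' Z g : W.toAffine.Point} {μ l : ℤ} (hl : Odd l)
    (hG : IsOfFinAddOrder (y - y' - (2 : ℤ) • Z)) (hA : IsOfFinAddOrder (μ • y' - l • g))
    (hg₁ : W.xSqClass g ≠ 1) (hg₂ : W.xSqClass g ≠ sqClass W.a₄) :
    ∀ R : W.toAffine.Point, y - (2 : ℤ) • R ∉ AddCommGroup.torsion W.toAffine.Point := by
  intro R hR
  have ht : IsOfFinAddOrder (y - (2 : ℤ) • R) := (AddCommGroup.mem_torsion _).mp hR
  exact W.ne_two_zsmul_add_of_oddMultiple hD hb hl hG hA hg₁ hg₂ R _ ht (by abel)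

/-! ### Reading `α(g) ∉ {1, [b]}` off the coordinates -/

/-- For an affine point `g = (x, y)` with `x ≠ 0`: `α(g) ≠ 1` iff `x` is not a square, and
`α(g) ≠ [b]` iff `x·b` is not a square. [cite: SilvermanTate2015, §3.5] -/
theorem xSqClass_ne_one_and_ne_of_not_isSquare {x y : F} (h : W.toAffine.Nonsingular x y) (hx : x ≠ 0)
    (h₁ : ¬ IsSquare x) (h₂ : ¬ IsSquare (x * W.a₄)) :
    W.xSqClass (.some x y h) ≠ 1 ∧ W.xSqClass (.some x y h) ≠ sqClass W.a₄ := by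
  have hb := a₄_ne_zero W
  rw [xSqClass_some_of_ne_zero h hx]
  refine ⟨fun e => h₁ ?_, fun e => h₂ ?_⟩
  · obtain ⟨u, hu⟩ := (sqClass_eq_one_iff hx).mp e
    exact ⟨u, by rw [hu, pow_two]⟩
  · have e' : sqClass (x * W.a₄) = 1 := by rw [sqClass_mul hx hb, e, Affine.SqUnits.mul_self]
    obtain ⟨u, hu⟩ := (sqClass_eq_one_iff (mul_ne_zero hx hb)).mp e'
    exact ⟨u, by rw [hu, pow_two]⟩

end WeierstrassCurve
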